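import Summits.ValiantsHypothesis.ValiantsHypothesis.Theses.DivisionGap
import Summits.ValiantsHypothesis.ValiantsHypothesis.Theorems.DivisionGapDefs
import Summits.ValiantsHypothesis.ValiantsHypothesis.Theorems.DivisionGapPerDivisionHardStubTorusSupport
import Summits.ValiantsHypothesis.ValiantsHypothesis.Theorems.DivisionGapPerDivisionHardStubFaceDescent
import Summits.ValiantsHypothesis.ValiantsHypothesis.Theorems.DivisionGapPerDivisionHardStubJssContraction
import Summits.ValiantsHypothesis.ValiantsHypothesis.Theorems.DivisionGapPerDivisionHardStubBlockArsenal
import Summits.ValiantsHypothesis.ValiantsHypothesis.Theorems.DivisionGapPerDivisionHardStubSparseGraphRigid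

/-!
# Crux `DivisionGap.PerDivisionHard` (stmt-ValiantsHypothesis-5065) — the SPARSE-VARIABLE-GRAPH
RUNG, unconditionally

`PerDivisionHard` asks, for every `c` and all large `n`, that every nonzero cofactor
`h ∈ ℝ≥0[x_ij]` satisfies `2^{(log₂ n + c)^c} < L(per_n · h) + L(h)` (monotone fan-in-two
`complexity` over `ℝ≥0`).  This file proves it for all cofactors whose VARIABLE GRAPH
`cells(h) = h.support.biUnion (·.support)` (the cells `(r, s)` such that `x_rs` occurs in `h`) has
all row and column degrees at most `n / (log₂ n + e)^e`, for a suitable `e = e(c)`: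

* `perDivisionHard_sparseGraph` — **∀ c, ∃ e n₀, ∀ n ≥ n₀, ∀ h ≠ 0 with all row and column
  degrees of `cells(h)` at most `n / (log₂ n + e)^e`: `2^{(log₂ n + c)^c} < L(per_n · h) + L(h)`.**

Such `h` may have any degree and exponentially many monomials and need not be a product:
polynomials in the variables of a band of width `n / polylog`, of a bounded-degree bipartite
graph, of a sparse face of the Birkhoff polytope (face permanents `per_E` for `E` of maximal
degree `n / polylog`, directed-spanning-tree-type polynomials on sparse digraphs, …) — a class
disjoint in spirit from the sparse rung (`perDivisionHard_sparse`, few monomials) and the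
product-of-sparse rung (`perDivisionHard_sparseProduct`).  Together with the refuters' criterion
(S) it localises the open stub K2′ of line `pair-descent-jss-endpoint` to cofactors whose
variable graph is dense in some row or column at every polylog scale.

Proof: the composition template of `perDivisionHard_sparse` with `stub_sparseGraphRigid`
(`Theorems/DivisionGapPerDivisionHardStubSparseGraphRigid.lean`) in place of `stub_sparseRigid`:
torus normal form keeping a sub-support (`stub_torusSupport`; the degree bounds of the variable
graph pass to sub-supports) → a placement of `K_{b,b} ⊕ M₀`, `b = (log₂ n + d)^d`,
`Δ = n / (log₂ n + d + 2)^{d+2}`, `b (Δ + 2) ≤ n` (`four_mul_logPow_le`), on which the top fibre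
is a single monomial (`stub_sparseGraphRigid`) → face descent to `x^u · per_G`
(`stub_faceDescent`) → the monomial is stripped at polynomial cost (`stub_jssContraction`) → the
placed face is harder than that (`stub_blockArsenal` with `k = 0`). [folklore]
-/

noncomputable section

-- `Summit.ValiantsHypothesis.ValiantsHypothesis.…` is the tree's mandated single-conjunct layout
-- (Sub = Summit), so the duplicated namespace component is intended.
set_option linter.dupNamespace false

namespace Summit.ValiantsHypothesis.ValiantsHypothesis.Theorems.DivisionGapPerDivisionHard

open MvPolynomial Literature.Computability.AlgebraicComplexity
open scoped NNReal

/-- Polylog bookkeeping: `4 (log₂ n + d)^d ≤ n` for all large `n` (from `growth`: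
`16 q³ ≤ 2^{log₂ n}` with `q = (log₂ n + d + 1)^{d+1} ≥ (log₂ n + d)^d`). [folklore] -/
theorem four_mul_logPow_le (d : ℕ) : ∃ n₀ : ℕ, ∀ n ≥ n₀, 4 * (Nat.log 2 n + d) ^ d ≤ n := by
  obtain ⟨L₀, hL₀⟩ := growth d
  refine ⟨2 ^ L₀, fun n hn => ?_⟩
  have hn0 : n ≠ 0 := by
    have : 1 ≤ 2 ^ L₀ := Nat.one_le_two_pow
    omega
  have hL : L₀ ≤ Nat.log 2 n := Nat.le_log_of_pow_le one_lt_two hn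
  have h2L : 2 ^ Nat.log 2 n ≤ n := Nat.pow_log_le_self 2 hn0
  have hq := hL₀ (Nat.log 2 n) hL
  set L := Nat.log 2 n with hLdef
  set q := (L + d + 1) ^ (d + 1) with hqdef
  have hq1 : 1 ≤ q := Nat.one_le_pow _ _ (Nat.succ_pos _)
  have hbq : (L + d) ^ d ≤ q :=
    (Nat.pow_le_pow_left (Nat.le_succ _) d).trans
      (Nat.pow_le_pow_right (Nat.succ_pos _) (Nat.le_succ d))
  have hqq : q ≤ q * (q * q) := Nat.le_mul_of_pos_right q (Nat.mul_pos hq1 hq1)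
  calc 4 * (L + d) ^ d ≤ 4 * q := Nat.mul_le_mul_left 4 hbq
    _ ≤ 16 * (q * (q * q)) := Nat.mul_le_mul (by norm_num) hqq
    _ ≤ 2 ^ L := hq
    _ ≤ n := h2L

/-- **The sparse-variable-graph rung of `PerDivisionHard`.**  For every `c` there are `e` and
`n₀` such that for all `n ≥ n₀` and every nonzero `h ∈ ℝ≥0[x_ij]` (`n × n` matrix variables)
whose variable graph `cells(h) = h.support.biUnion (·.support)` has at most `n / (log₂ n + e)^e`
cells in every row and in every column, `2^{(log₂ n + c)^c} < L(per_n · h) + L(h)` in the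
monotone fan-in-two `complexity` over `ℝ≥0`: the permanent admits no quasi-polynomially cheap
monotone pair whose cofactor lives on a variable graph of row and column degrees `n / polylog` —
whatever its degree, its number of monomials, product or not (polynomials in the variables of a
band, of a bounded-degree graph, of a sparse face of the Birkhoff polytope).  Composition of the
landed stubs of line `pair-descent-jss-endpoint`: torus normal form with sub-support, rigidity of
a greedily placed `K_{b,b} ⊕ M₀` off the variable graph (`stub_sparseGraphRigid`), face descent,
Jukna–Seiwert–Sergeev contraction, hardness of the block face (`k = 0`). -/
theorem perDivisionHard_sparseGraph :
    ∀ c : ℕ, ∃ e n₀ : ℕ, ∀ n ≥ n₀, ∀ h : MvPolynomial (Fin n × Fin n) ℝ≥0, h ≠ 0 →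
      (∀ r : Fin n, ((h.support.biUnion fun m => m.support).filter (fun x => x.1 = r)).card ≤
        n / (Nat.log 2 n + e) ^ e) →
      (∀ s : Fin n, ((h.support.biUnion fun m => m.support).filter (fun x => x.2 = s)).card ≤
        n / (Nat.log 2 n + e) ^ e) →
      2 ^ ((Nat.log 2 n + c) ^ c) < complexity (perPoly (Fin n) ℝ≥0 * h) + complexity h := by
  intro c
  obtain ⟨κ, hcon⟩ := stub_jssContraction
  obtain ⟨d, n₁, hhard⟩ := stub_blockArsenal c κ
  obtain ⟨n₂, hgrow⟩ := four_mul_logPow_le d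
  refine ⟨d + 2, n₁ + n₂, ?_⟩
  intro n hn h hh hrow hcol
  -- the parameters: `b = (L + d)^d`, `Δ = n / (L + d + 2)^{d+2}`, `b (Δ + 2) ≤ n`
  have h4b := hgrow n (by omega)
  set L := Nat.log 2 n with hL
  set b := (L + d) ^ d with hb
  set D := (L + (d + 2)) ^ (d + 2) with hD
  set Δ := n / D with hΔ
  have hb1 : 1 ≤ b := by
    rw [hb]
    rcases Nat.eq_zero_or_pos d with hd | hd
    · rw [hd, pow_zero]
    · exact Nat.one_le_pow _ _ (by omega)
  have hD4 : 4 * b ≤ D := by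
    rw [hD, hb, pow_add, mul_comm 4]
    exact Nat.mul_le_mul (Nat.pow_le_pow_left (by omega) d)
      (le_trans (by norm_num) (Nat.pow_le_pow_left (show 2 ≤ L + (d + 2) by omega) 2))
  have h4Δ : 4 * (b * Δ) ≤ n :=
    calc 4 * (b * Δ) = 4 * b * Δ := (Nat.mul_assoc _ _ _).symm
      _ ≤ D * Δ := Nat.mul_le_mul_right _ hD4
      _ ≤ n := Nat.mul_div_le n D
  have hbn : b * (Δ + 2) ≤ n := by
    rw [Nat.mul_add]
    omega
  -- torus normal form keeping a sub-support; the degree bounds pass to `h'`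
  obtain ⟨h', hh', htor, hsupp, hle1, -⟩ := stub_torusSupport n h hh
  have hsub : (h'.support.biUnion fun m => m.support) ⊆ h.support.biUnion fun m => m.support :=
    Finset.biUnion_subset_biUnion_of_subset_left _ hsupp
  have hrow' : ∀ r : Fin n,
      ((h'.support.biUnion fun m => m.support).filter (fun x => x.1 = r)).card ≤ Δ := fun r =>
    le_trans (Finset.card_le_card (Finset.filter_subset_filter _ hsub)) (hrow r)
  have hcol' : ∀ s : Fin n,
      ((h'.support.biUnion fun m => m.support).filter (fun x => x.2 = s)).card ≤ Δ := fun s =>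
    le_trans (Finset.card_le_card (Finset.filter_subset_filter _ hsub)) (hcol s)
  -- rigidity of a greedily placed `K_{b,b} ⊕ M₀`
  obtain ⟨m, eR, eC, w, u, hcut, hsingle⟩ :=
    stub_sparseGraphRigid n b Δ h' hh' htor hb1 hbn hrow' hcol'
  by_contra hlt
  have hle : complexity (perPoly (Fin n) ℝ≥0 * h) + complexity h ≤ 2 ^ ((L + c) ^ c) :=
    not_lt.mp hlt
  -- face descent: `x^u · per_G` is (up to one gate) no more expensive than `per · h'`
  have hdesc := stub_faceDescent n (placedBlock eR eC) w h' u hcut hh' hsingle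
  have h1 : complexity (monomial u (1 : ℝ≥0) * facePer (placedBlock eR eC)) ≤
      2 ^ ((L + c) ^ c) + 1 :=
    calc complexity (monomial u (1 : ℝ≥0) * facePer (placedBlock eR eC))
        ≤ complexity (perPoly (Fin n) ℝ≥0 * h') + 1 := hdesc
      _ ≤ complexity (perPoly (Fin n) ℝ≥0 * h) + 1 := Nat.add_le_add_right hle1 1
      _ ≤ 2 ^ ((L + c) ^ c) + 1 :=
          Nat.add_le_add_right (le_trans (Nat.le_add_right _ _) hle) 1
  -- JSS contraction: strip the monomial at polynomial cost
  have h2 : complexity (facePer (placedBlock eR eC)) ≤ ((n + 2) * (2 ^ ((L + c) ^ c) + 3)) ^ κ :=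
    calc complexity (facePer (placedBlock eR eC))
        ≤ ((n + 2) * (complexity (monomial u (1 : ℝ≥0) * facePer (placedBlock eR eC)) + 2)) ^ κ :=
          hcon n (facePer (placedBlock eR eC)) u
      _ ≤ ((n + 2) * (2 ^ ((L + c) ^ c) + 3)) ^ κ :=
          Nat.pow_le_pow_left (Nat.mul_le_mul_left _ (by omega)) κ
  -- the placed block face (`k = 0`, `b = (L + d)^d`) is harder than that
  have h3 := hhard n (by omega) b 0 m eR eC (le_of_eq hb.symm)
  exact absurd (lt_of_lt_of_le h3 h2) (lt_irrefl _)

end Summit.ValiantsHypothesis.ValiantsHypothesis.Theorems.DivisionGapPerDivisionHard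

end
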